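import Mathlib
import Summits.Ventures.HodgeRepro.Tier4.Common.AdelicDefs
import Summits.Ventures.HodgeRepro.Tier4.Common.CompactOpenLevel
import Summits.Ventures.HodgeRepro.Tier4.Common.LevelBasis
import Summits.Ventures.HodgeRepro.Tier4.Line1.RTFSetting
import Summits.Ventures.HodgeRepro.Tier4.Line1.OrbitalTools
import Summits.Ventures.HodgeRepro.Tier4.Line1.RationalPoints
import Summits.Ventures.HodgeRepro.Tier4.Line1.RealisedSetting
import Summits.Ventures.HodgeRepro.Tier4.Line1.AdelicParts
import Summits.Ventures.HodgeRepro.Tier4.Line1.IsolatingTestsDeepLevel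
import Summits.Ventures.HodgeRepro.Tier4.Line1.RationalConjFinite
import Summits.Ventures.HodgeRepro.Tier4.Line1.ArchMatrixCoeff
import Summits.Ventures.HodgeRepro.Tier4.Line1.FinLevelCompact
import Summits.Ventures.HodgeRepro.Tier4.Line1.FiniteLevelIsolation
import Summits.Ventures.HodgeRepro.Tier4.Line1.FiniteTypeAlgebra

/-!
# Tier4/Line1/DoubleCosetIsolation — F2‴: isolation on the DOUBLE COSET `K_N γ₀ K_N` (archimedean-saturated on both
sides)

Blind re-derivation cell `pub-hodge-repro`, Tier 4 (README §9–§10), seat t4-L1-p4 (gen 4), LINE L1.  Target tree path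
`lean/Summits/Ventures/HodgeRepro/Tier4/Line1/DoubleCosetIsolation.lean`.  Imports this seat's FiniteLevelIsolation
(`infinitePart`, `GA.ofInfPart` / `GA.ofFinPart`, `isCompact_infinitePart_of_archImage`) and RationalConjFinite
(`orbitOf_eq_of_finPart_conj`, the finite-adelic core), p2's FinLevelCompact (`isCompact_finLevel`), ArchMatrixCoeff
(`finLevel`) and FiniteTypeAlgebra (`finLevel_antitone`, `conj_mem_infinitePart`), typer-2's LevelBasis
(`exists_levelK_subset_nhds_one`).  0 print.

WHY.  For the archimedean half of the F2′ → (S1b) bridge the isolating pair's `f₁` must be of finite-rank left-type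
under the OPEN subgroup `K_N = finLevel W N = K_f(N) × G_∞`; such a function is `G_∞`-finite, hence (on a compact
`G_∞`) a matrix coefficient in the archimedean variable — it can never be supported in a small neighbourhood of
`γ₀`.  The isolating set must therefore be saturated by `G_∞` (indeed by `K_N`) on BOTH sides: the double coset
`K_N γ₀ K_N`, compact, open, bi-`K_N`-invariant.  FiniteLevelIsolation's F2″ (`exists_level_isolating`) covers the
one-sided `γ₀ K_N`; this module upgrades it.

WHAT IS PROVED — **`exists_level_isolating_doubleCoset`** (the two helpers `finLevel_antitone` and
`conj_mem_infinitePart` are p2's, FiniteTypeAlgebra, consumed by name): under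
`hC : IsCompact (archImage W)` (p2's typed form of «`G_∞` is compact», F-L1-ARCH), for a regular rational `γ₀` there is
`N ≠ 0` such that every rational `γ` with `t⁻¹ γ t′ ∈ K_N · {γ₀} · K_N` for some `t ∈ closure DT`, `t′ ∈ closure DT′`
lies in the rational double coset of `γ₀`.  Proof = FiniteLevelIsolation's, with the membership unpacked through the
factorisation `k = k_∞ k_f` and the normality of `G_∞`: `γ₀⁻¹ t⁻¹ γ t′ = (γ₀⁻¹ a₁ γ₀) · a₂′ · (γ₀⁻¹ b₁ γ₀) · b₂` with
`a`'s in `G_∞` and `b`'s in `K(N)`, so it lies in `G_∞ · (γ₀⁻¹ K(N) γ₀ · K(N))`; the compact set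
`C = γ₀⁻¹ · {t⁻¹ γ t′}` of a γ outside the double coset of `γ₀` misses `G_∞` (the finite-adelic core), the compact-open
separation gives `V ∈ 𝓝 1` with `G_∞ · V ⊆ Cᶜ`, and `K(N)` is taken inside `V₁ ∩ γ₀ V₁ γ₀⁻¹` with `V₁ V₁ ⊆ V`; the
finite hit set of the level-`1` double coset and the product level finish as before.

Nothing here says anything about the status of the Hodge conjecture for CM abelian varieties, which is NOT proved
(HC_CM is NOT proved by anyone in this repository).
-/

set_option autoImplicit false

noncomputable section

namespace Summit.Ventures.HodgeRepro.Tier4.Line1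

open Matrix NumberField IsDedekindDomain Topology Summit.Ventures.HodgeRepro.Tier4.Common
open scoped NumberField Pointwise

section Isolation

open MeasureTheory

variable {k : Type} [Field k] [NumberField k] (W : PlaneData k) [MeasurableSpace (GA W)] [BorelSpace (GA W)]
  (hW : IsDefinite W) (hg : IsGenuineRow W) (R : RTFData W) (μ : Measure (GA W)) [μ.IsHaarMeasure]
  [R.μT.IsHaarMeasure] [R.μT'.IsHaarMeasure] (hT : IsCompact (closure R.DT)) (hT' : IsCompact (closure R.DT'))

/-- **F2‴ — isolation on the double coset**: with `hC : IsCompact (archImage W)` there is a level `N ≠ 0` such that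
every rational `γ` with `t⁻¹ γ t′ ∈ K_N · {γ₀} · K_N` (`K_N = finLevel W N = K_f(N) × G_∞`) for some `t ∈ closure DT`,
`t′ ∈ closure DT′` lies in the rational double coset of `γ₀`. -/
theorem exists_level_isolating_doubleCoset (hC : IsCompact (archImage W)) (γ₀ : rationalPoints W)
    (hreg : IsLinRegular W γ₀) :
    ∃ N : ℕ, N ≠ 0 ∧ ∀ t ∈ closure (Setting.ofAdelic W hW hg R μ hT hT').DT,
      ∀ t' ∈ closure (Setting.ofAdelic W hW hg R μ hT hT').DT', ∀ γ : (Setting.ofAdelic W hW hg R μ hT hT').Gk,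
        (t : GA W)⁻¹ * γ * t' ∈
          (finLevel W N : Set (GA W)) * {(γ₀ : GA W)} * (finLevel W N : Set (GA W)) →
        (Setting.ofAdelic W hW hg R μ hT hT').orbitOf γ = (Setting.ofAdelic W hW hg R μ hT hT').orbitOf γ₀ := by
  classical
  haveI : T2Space (GA W) := t2Space_GA W
  have hcomp : IsCompact (infinitePart W : Set (GA W)) := isCompact_infinitePart_of_archImage W hC
  have hK1 : IsCompact (finLevel W 1 : Set (GA W)) := isCompact_finLevel W hC one_ne_zero
  -- the level-`1` double coset, compact
  have hM : IsCompact ((finLevel W 1 : Set (GA W)) * {(γ₀ : GA W)} * (finLevel W 1 : Set (GA W))) :=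
    (hK1.mul isCompact_singleton).mul hK1
  -- for every rational point outside the double coset of `γ₀`, a level whose double coset misses it
  have hbad : ∀ γ : (Setting.ofAdelic W hW hg R μ hT hT').Gk,
      (Setting.ofAdelic W hW hg R μ hT hT').orbitOf γ ≠ (Setting.ofAdelic W hW hg R μ hT hT').orbitOf γ₀ →
      ∃ Nγ : ℕ, Nγ ≠ 0 ∧ ∀ t ∈ closure (Setting.ofAdelic W hW hg R μ hT hT').DT,
        ∀ t' ∈ closure (Setting.ofAdelic W hW hg R μ hT hT').DT',
        (t : GA W)⁻¹ * γ * t' ∉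
          (finLevel W Nγ : Set (GA W)) * {(γ₀ : GA W)} * (finLevel W Nγ : Set (GA W)) := by
    intro γ hne
    have hA : IsCompact ((fun t : (Setting.ofAdelic W hW hg R μ hT hT').T => (t : GA W)) ''
        closure (Setting.ofAdelic W hW hg R μ hT hT').DT) :=
      (Setting.ofAdelic W hW hg R μ hT hT').compT.image continuous_subtype_val
    have hB : IsCompact ((fun t : (Setting.ofAdelic W hW hg R μ hT hT').T' => (t : GA W)) ''
        closure (Setting.ofAdelic W hW hg R μ hT hT').DT') :=
      (Setting.ofAdelic W hW hg R μ hT hT').compT'.image continuous_subtype_val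
    -- the compact set `C = γ₀⁻¹ · {t⁻¹ γ t′}`
    set C : Set (GA W) := (fun p : GA W × GA W => (γ₀ : GA W)⁻¹ * (p.1⁻¹ * γ * p.2)) ''
      (((fun t : (Setting.ofAdelic W hW hg R μ hT hT').T => (t : GA W)) ''
          closure (Setting.ofAdelic W hW hg R μ hT hT').DT) ×ˢ
        ((fun t : (Setting.ofAdelic W hW hg R μ hT hT').T' => (t : GA W)) ''
          closure (Setting.ofAdelic W hW hg R μ hT hT').DT')) with hCdef
    have hCc : IsCompact C :=
      (hA.prod hB).image (continuous_const.mul ((continuous_fst.inv.mul continuous_const).mul continuous_snd))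
    -- `C` misses `G_∞`: the finite-adelic core
    have hdisj : ∀ t ∈ closure (Setting.ofAdelic W hW hg R μ hT hT').DT,
        ∀ t' ∈ closure (Setting.ofAdelic W hW hg R μ hT hT').DT',
        (γ₀ : GA W)⁻¹ * ((t : GA W)⁻¹ * γ * t') ∉ infinitePart W := by
      intro t _ t' _ hmem
      apply hne
      have h1 : finM k (GA.mat W ((t : GA W)⁻¹ * γ * t')) = finM k (GA.mat W (γ₀ : GA W)) := by
        have hm := (mem_infinitePart W _).1 hmem
        rw [GA.mat_mul, finM_mul] at hm
        calc finM k (GA.mat W ((t : GA W)⁻¹ * γ * t'))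
            = (finM k (GA.mat W (γ₀ : GA W)) * finM k (GA.mat W (γ₀ : GA W)⁻¹)) *
                finM k (GA.mat W ((t : GA W)⁻¹ * γ * t')) := by
              rw [← finM_mul, GA.mat_mul_inv, finM_one, Matrix.one_mul]
          _ = finM k (GA.mat W (γ₀ : GA W)) *
                (finM k (GA.mat W (γ₀ : GA W)⁻¹) * finM k (GA.mat W ((t : GA W)⁻¹ * γ * t'))) :=
              Matrix.mul_assoc _ _ _
          _ = finM k (GA.mat W (γ₀ : GA W)) := by rw [hm, Matrix.mul_one]
      exact orbitOf_eq_of_finPart_conj W hW hg R μ hT hT' γ γ₀ hreg t.2 t'.2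
        (fun i j => congrFun (congrFun h1 i) j)
    have hU : IsOpen Cᶜ := hCc.isClosed.isOpen_compl
    have hsub : (infinitePart W : Set (GA W)) ⊆ Cᶜ := by
      rintro a ha ⟨⟨_, _⟩, ⟨⟨τ, hτ, rfl⟩, ⟨τ', hτ', rfl⟩⟩, hfa⟩
      rw [← hfa] at ha
      exact hdisj τ hτ τ' hτ' ha
    obtain ⟨V, hV, hVsub⟩ := compact_open_separated_mul_right hcomp hU hsub
    -- `V₁ V₁ ⊆ V`, and `K(N)` inside `V₁ ∩ γ₀ V₁ γ₀⁻¹`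
    obtain ⟨V₁, hV₁o, hV₁1, hV₁V⟩ := exists_open_nhds_one_mul_subset hV
    have hV₁n : V₁ ∈ 𝓝 (1 : GA W) := hV₁o.mem_nhds hV₁1
    have hV₂n : (fun x : GA W => (γ₀ : GA W)⁻¹ * x * γ₀) ⁻¹' V₁ ∈ 𝓝 (1 : GA W) := by
      have hc : Continuous fun x : GA W => (γ₀ : GA W)⁻¹ * x * γ₀ :=
        (continuous_const.mul continuous_id).mul continuous_const
      have h1 : (γ₀ : GA W)⁻¹ * 1 * γ₀ = 1 := by simp
      exact hc.continuousAt.preimage_mem_nhds (by simp only [h1]; exact hV₁n)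
    obtain ⟨Nγ, hNγ, hKV⟩ := exists_levelK_subset_nhds_one W (Filter.inter_mem hV₁n hV₂n)
    refine ⟨Nγ, hNγ, fun t ht t' ht' hmem => ?_⟩
    -- unpack the double coset membership and factor the two level elements
    obtain ⟨y, hy, k₂, hk₂, hyk⟩ := Set.mem_mul.1 hmem
    obtain ⟨k₁, hk₁, g₀, hg₀, hkg⟩ := Set.mem_mul.1 hy
    rw [Set.mem_singleton_iff] at hg₀
    subst hg₀
    rw [SetLike.mem_coe] at hk₁ hk₂
    have hin : (γ₀ : GA W)⁻¹ * ((t : GA W)⁻¹ * γ * t') ∈ C :=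
      ⟨((t : GA W), (t' : GA W)), ⟨⟨t, ht, rfl⟩, ⟨t', ht', rfl⟩⟩, rfl⟩
    apply hVsub _ hin
    rw [← hyk, ← hkg, ← GA.ofInfPart_mul_ofFinPart W k₁, ← GA.ofInfPart_mul_ofFinPart W k₂]
    set a₁ := GA.ofInfPart W k₁ with ha₁
    set b₁ := GA.ofFinPart W k₁ with hb₁
    set a₂ := GA.ofInfPart W k₂ with ha₂
    set b₂ := GA.ofFinPart W k₂ with hb₂
    have ha₁m : a₁ ∈ infinitePart W := GA.ofInfPart_mem_infinitePart W k₁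
    have ha₂m : a₂ ∈ infinitePart W := GA.ofInfPart_mem_infinitePart W k₂
    have hb₁m : b₁ ∈ levelK W Nγ := GA.ofFinPart_mem_levelK W hk₁
    have hb₂m : b₂ ∈ levelK W Nγ := GA.ofFinPart_mem_levelK W hk₂
    have hfac : (γ₀ : GA W)⁻¹ * (a₁ * b₁ * γ₀ * (a₂ * b₂)) =
        ((γ₀ : GA W)⁻¹ * a₁ * γ₀ * (((γ₀ : GA W)⁻¹ * b₁ * γ₀) * a₂ * ((γ₀ : GA W)⁻¹ * b₁ * γ₀)⁻¹)) *
          (((γ₀ : GA W)⁻¹ * b₁ * γ₀) * b₂) := by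
      group
    rw [hfac]
    refine Set.mul_mem_mul ((infinitePart W).mul_mem (conj_mem_infinitePart W ha₁m _) ?_) ?_
    · have := conj_mem_infinitePart W ha₂m ((γ₀ : GA W)⁻¹ * b₁ * γ₀)⁻¹
      rwa [inv_inv] at this
    · refine hV₁V (Set.mul_mem_mul ?_ (hKV hb₂m).1)
      exact (hKV hb₁m).2
  choose! Nf hNf using hbad
  -- the finite set of rational points hit by the level-`1` double coset, and the product level over its bad members
  set Γ : Finset (Setting.ofAdelic W hW hg R μ hT hT').Gk :=
    ((Setting.ofAdelic W hW hg R μ hT hT').finite_hit_closure hM).toFinset with hΓ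
  set N : ℕ := ∏ γ ∈ Γ.filter (fun γ =>
    (Setting.ofAdelic W hW hg R μ hT hT').orbitOf γ ≠ (Setting.ofAdelic W hW hg R μ hT hT').orbitOf γ₀), Nf γ
    with hN
  have hmono : ∀ {M N' : ℕ}, M ∣ N' → (finLevel W N' : Set (GA W)) * {(γ₀ : GA W)} * (finLevel W N' : Set (GA W)) ⊆
      (finLevel W M : Set (GA W)) * {(γ₀ : GA W)} * (finLevel W M : Set (GA W)) := fun hdvd =>
    Set.mul_subset_mul (Set.mul_subset_mul_right (SetLike.coe_subset_coe.2 (finLevel_antitone W hdvd)))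
      (SetLike.coe_subset_coe.2 (finLevel_antitone W hdvd))
  refine ⟨N, ?_, ?_⟩
  · rw [hN, Finset.prod_ne_zero_iff]
    intro γ hγ
    exact (hNf γ (Finset.mem_filter.1 hγ).2).1
  · intro t ht t' ht' γ hmem
    by_contra hne
    have hγΓ : γ ∈ Γ := by
      rw [hΓ, Set.Finite.mem_toFinset]
      exact ⟨t, ht, t', ht', hmono (one_dvd N) hmem⟩
    have hdvd : Nf γ ∣ N := Finset.dvd_prod_of_mem _ (Finset.mem_filter.2 ⟨hγΓ, hne⟩)
    exact (hNf γ hne).2 t ht t' ht' (hmono hdvd hmem)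

end Isolation

end Summit.Ventures.HodgeRepro.Tier4.Line1

end
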